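import Summits.NavierStokesRegularity.NavierStokesRegularity.Theses.RootDecompLitSlice

/-!
# `RootDecompLitSlice.Assembly` HOLDS (route `RootDecompLitSlice`, decomp-ns node N16, (A)-forest)

The assembly item `Assembly : NoTypeIBlowup → NoEnergyAtom → AtomFreeBlowupIsTame →
NoSupercriticalTameScar → NoLitInvisibleTransient → LitCriticalSingularityIsTypeI → NoDarkBall →
NavierStokesRegularity` (stmt-NavierStokesRegularity-29570) of route
`Summits/NavierStokesRegularity/NavierStokesRegularity/Theses/RootDecompLitSlice.lean` is, by `rfl`
unfolding, the type of the route's gate-certified deciding theorem `RootDecompLitSlice.closes` (D-0027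
§2.1): P1 → P2 → J1 → U → T₃ᴸ → G₂ᴸ → D → Clay (A), all seven consumed through N1's
`RootDecompTerminalEnergy.closes`, the landed terminal-trace singular point, unique continuation off the
dark ball and the cylinder `L^∞` bookkeeping — all inside `closes` itself. Pure logic; recorded by the
census probe #43 (`assembly_by_name`, decomp-ns-census-1 g49).

HONEST FRAMING (D-0179): this closes a kind-`assembly` BOOKKEEPING item of a DRAFT route — it proves
that the glue proves the implication, nothing more. Every LEAF of the implication (P1 ⟨1217⟩, P2
⟨24827⟩, J1 ⟨24829⟩, U ⟨29565⟩ = Uᶜ ⟨31733⟩ ∧ Uᵃ ⟨31734⟩, T₃ᴸ ⟨29562⟩, G₂ᴸ ⟨29564⟩) except D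
⟨29563⟩ is OPEN; the loads of the route (Uᵃ: Tao-II; P1: rigidity at the scale-invariant corner) are
untouched; nothing here proves Navier–Stokes regularity (rung 0). [folklore]
-/

set_option linter.dupNamespace false

namespace Summit.NavierStokesRegularity.NavierStokesRegularity.Theorems.RootDecompLitSliceAssembly

/-- **`Assembly` HOLDS**: the route's deciding theorem `closes`, read as a proof of the assembly item
(stmt-NavierStokesRegularity-29570). Bookkeeping; every leaf but D stays open. [folklore] -/
theorem assembly_holds : Theses.RootDecompLitSlice.Assembly :=
  fun hP1 hP2 hJ1 hU hT hG hD => Theses.RootDecompLitSlice.closes hP1 hP2 hJ1 hU hT hG hD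

end Summit.NavierStokesRegularity.NavierStokesRegularity.Theorems.RootDecompLitSliceAssembly
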